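import Mathlib.NumberTheory.Harmonic.Bounds
import Mathlib.Analysis.PSeries
import HarnessLib

/-!
# Transplant sharpness LIII — the arm sums of the reinforced-ray programme (pure real analysis)

builds on p205010 (kernel theorem, internal audit signed; external expert review pending).
Status sentence (coordinator 2026-08-20T04:30Z): "θ(p_c) = 0 on ℤ^d, all d ≥ 2 — kernel-verified (Lean 4/Mathlib,
standard axioms); internal adversarial audit SIGNED 2026-08-20 04:29Z; external expert review pending."

Lane `prim-bschramm`, seat p5 (sharpness); memo `run/shared/lean/prim/bschramm/P5-SHARPNESS.md` §48 (row 85, kernel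
programme "RAY": the square lattice with a reinforced ray is continuous at its critical point `1/2`; plan
`run/shared/lean/prim/bschramm/prim-bschramm-p5-g22/RAY-PLAN.md` §4, items L1).

This file is the elementary real analysis of the second-moment matching bound, kept free of any percolation import so
that the probabilistic modules only plug in constants:

* `sum_sq_le_of_armSquare` — if a sequence `f : ℕ → ℝ` satisfies the quantitative half-plane bound
  `c · (r/n) · f(r)² ≤ f(n)²` for `1 ≤ r ≤ n` ("LEMMA X" of the plan, `β₁⁺ ≤ 1/2`), then
  `Σ_{r=1}^{n} f(r)² ≤ c⁻¹ · n · f(n)² · (1 + log n)`;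
* `mul_sq_ge_of_armSquare` — the `r = 1` instance `c · f(1)² ≤ n · f(n)²`;
* `matching_ratio_ge` — the algebra of the matching count: with the above, a window of `n` sites, arm probability
  `α ≥ c₄ f(n)`, two-point constant `C₁` and bridge probability `s ∈ (0, 1]`, the Chung–Erdős ratio satisfies
  `s n α² / (1 + 2 s C₁² Σ_{r ≤ n} f(r)²) ≥ c₅ · s / (1 + log n)` with an explicit `c₅ > 0` depending only on
  `c, c₄, C₁, f(1)`.

References: Y. Zhang, Ann. Probab. 22 (1994) 803–819 (the line version of row 85); G. Grimmett, *Percolation* (1999), §11.7.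
-/

noncomputable section

namespace Summit.CriticalPhenomena.PercolationContinuityZ3.Theorems.TransplantSharpness

namespace Ray

open Finset

/-! ## The harmonic sum

`Σ_{r=1}^{n} 1/r ≤ 1 + log n` is Mathlib's `harmonic_le_one_add_log`; the tree already has the `ℝ`-recast under
several names (`Literature.NumberTheory.Sieve.harmonic_Icc_le`, …), so it is only used inline below. -/

/-! ## Sums of squared arm probabilities under the quantitative bound `β₁⁺ ≤ 1/2` -/

/- The standing hypothesis "LEMMA X" of the plan (`β₁⁺ ≤ 1/2`, quantitative) is written out in every statement as
`hX : ∀ r n : ℕ, 1 ≤ r → r ≤ n → c * ((r : ℝ) / n) * f r ^ 2 ≤ f n ^ 2`. -/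

/-- Under LEMMA X with constant `c > 0`: each term is dominated, `f(r)² ≤ c⁻¹ (n/r) f(n)²`. [folklore] -/
theorem sq_le_of_armSquare {f : ℕ → ℝ} {c : ℝ} (hc : 0 < c) (hX : ∀ r n : ℕ, 1 ≤ r → r ≤ n → c * ((r : ℝ) / n) * f r ^ 2 ≤ f n ^ 2)
    {r n : ℕ} (hr : 1 ≤ r) (hrn : r ≤ n) :
    f r ^ 2 ≤ c⁻¹ * ((n : ℝ) / r) * f n ^ 2 := by
  have h := hX r n hr hrn
  have hr0 : (0 : ℝ) < r := by exact_mod_cast hr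
  have hn0 : (0 : ℝ) < n := by exact_mod_cast (lt_of_lt_of_le hr hrn)
  -- multiply the hypothesis by `n / (c r)`
  have hpos : 0 < (n : ℝ) / (c * r) := by positivity
  have h2 := mul_le_mul_of_nonneg_left h hpos.le
  have lhs : (n : ℝ) / (c * r) * (c * ((r : ℝ) / n) * f r ^ 2) = f r ^ 2 := by
    field_simp
  have rhs : (n : ℝ) / (c * r) * f n ^ 2 = c⁻¹ * ((n : ℝ) / r) * f n ^ 2 := by
    field_simp
  rw [lhs, rhs] at h2
  exact h2

/-- **The arm-square sum**: `Σ_{r=1}^{n} f(r)² ≤ c⁻¹ n f(n)² (1 + log n)` under LEMMA X with constant `c > 0`.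
[folklore] -/
theorem sum_sq_le_of_armSquare {f : ℕ → ℝ} {c : ℝ} (hc : 0 < c) (hX : ∀ r n : ℕ, 1 ≤ r → r ≤ n → c * ((r : ℝ) / n) * f r ^ 2 ≤ f n ^ 2) (n : ℕ) :
    ∑ r ∈ Icc 1 n, f r ^ 2 ≤ c⁻¹ * n * f n ^ 2 * (1 + Real.log n) := by
  calc ∑ r ∈ Icc 1 n, f r ^ 2 ≤ ∑ r ∈ Icc 1 n, c⁻¹ * ((n : ℝ) / r) * f n ^ 2 := by
        refine sum_le_sum fun r hr => ?_
        rw [mem_Icc] at hr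
        exact sq_le_of_armSquare hc hX hr.1 hr.2
    _ = c⁻¹ * n * f n ^ 2 * ∑ r ∈ Icc 1 n, ((r : ℝ))⁻¹ := by
        rw [mul_sum]
        refine sum_congr rfl fun r _ => ?_
        rw [div_eq_mul_inv]
        ring
    _ ≤ c⁻¹ * n * f n ^ 2 * (1 + Real.log n) := by
        have hharm : ∑ r ∈ Icc 1 n, ((r : ℝ))⁻¹ ≤ 1 + Real.log n := by
          have h := harmonic_le_one_add_log n
          simpa [harmonic_eq_sum_Icc, Rat.cast_sum, Rat.cast_inv, Rat.cast_natCast] using h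
        refine mul_le_mul_of_nonneg_left hharm ?_
        have : 0 ≤ c⁻¹ := inv_nonneg.2 hc.le
        positivity

/-- The `r = 1` instance of LEMMA X: `c f(1)² ≤ n f(n)²` for `n ≥ 1`. [folklore] -/
theorem mul_sq_ge_of_armSquare {f : ℕ → ℝ} {c : ℝ} (hX : ∀ r n : ℕ, 1 ≤ r → r ≤ n → c * ((r : ℝ) / n) * f r ^ 2 ≤ f n ^ 2) {n : ℕ} (hn : 1 ≤ n) :
    c * f 1 ^ 2 ≤ n * f n ^ 2 := by
  have h := hX 1 n le_rfl hn
  have hn0 : (0 : ℝ) < n := by exact_mod_cast hn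
  have h2 := mul_le_mul_of_nonneg_left h hn0.le
  have lhs : (n : ℝ) * (c * ((1 : ℕ) / (n : ℝ)) * f 1 ^ 2) = c * f 1 ^ 2 := by
    push_cast
    field_simp
  rw [lhs] at h2
  exact h2

/-! ## The matching ratio -/

/-- The function `u ↦ u / (1 + K u)` is monotone on `u ≥ 0` for `K ≥ 0`. [folklore] -/
theorem div_one_add_mul_mono {K u v : ℝ} (hK : 0 ≤ K) (hu : 0 ≤ u) (huv : u ≤ v) :
    u / (1 + K * u) ≤ v / (1 + K * v) := by
  have h1 : 0 < 1 + K * u := by positivity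
  have hv : 0 ≤ v := hu.trans huv
  have h2 : 0 < 1 + K * v := by positivity
  rw [div_le_div_iff₀ h1 h2]
  nlinarith [mul_nonneg hK (sub_nonneg.2 huv)]

/-- **The matching ratio bound** (RAY-PLAN §3, last display). Data: a positive sequence `f` satisfying LEMMA X
(constant `c > 0`), a window size `n ≥ 1`, an arm probability `α` with `c₄ f(n) ≤ α` (`c₄ > 0`), a two-point constant `C₁`, a bridge
probability `s ∈ (0, 1]`. Then the Chung–Erdős ratio of the matching count,
`s n α² / (1 + 2 s C₁² Σ_{r=1}^{n} f(r)²)`, is at least `c₅ s / (1 + log n)` with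
`c₅ = c₄² u₀ / (1 + K u₀)`, `u₀ = c f(1)²`, `K = 2 C₁² / c`. [folklore] -/
theorem matching_ratio_ge {f : ℕ → ℝ} {c c₄ C₁ s α : ℝ} (hc : 0 < c) (hX : ∀ r n : ℕ, 1 ≤ r → r ≤ n → c * ((r : ℝ) / n) * f r ^ 2 ≤ f n ^ 2)
    (hf : ∀ k, 0 < f k) (hc₄ : 0 < c₄) {n : ℕ} (hn : 1 ≤ n) (hα : c₄ * f n ≤ α)
    (hs0 : 0 < s) (hs1 : s ≤ 1) :
    (c₄ ^ 2 * (c * f 1 ^ 2) / (1 + (2 * C₁ ^ 2 / c) * (c * f 1 ^ 2))) * s / (1 + Real.log n) ≤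
      s * n * α ^ 2 / (1 + 2 * s * C₁ ^ 2 * ∑ r ∈ Icc 1 n, f r ^ 2) := by
  -- abbreviations
  set u : ℝ := n * f n ^ 2 with hu
  set u₀ : ℝ := c * f 1 ^ 2 with hu₀
  set K : ℝ := 2 * C₁ ^ 2 / c with hK
  set L : ℝ := 1 + Real.log n with hL
  have hL1 : 1 ≤ L := by
    have : (1 : ℝ) ≤ n := by exact_mod_cast hn
    have := Real.log_nonneg this
    rw [hL]; linarith
  have hL0 : 0 < L := by linarith
  have hK0 : 0 ≤ K := by positivity
  have hu₀0 : 0 < u₀ := by have := hf 1; positivity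
  have hu0 : 0 < u := by
    have := hf n
    have hn0 : (0 : ℝ) < n := by exact_mod_cast hn
    positivity
  have hu₀u : u₀ ≤ u := mul_sq_ge_of_armSquare hX hn
  -- the sum bound: `Σ f(r)² ≤ c⁻¹ u L`
  have hsum : ∑ r ∈ Icc 1 n, f r ^ 2 ≤ c⁻¹ * u * L := by
    have h := sum_sq_le_of_armSquare hc hX n
    calc ∑ r ∈ Icc 1 n, f r ^ 2 ≤ c⁻¹ * n * f n ^ 2 * (1 + Real.log n) := h
      _ = c⁻¹ * u * L := by rw [hu, hL]; ring
  have hsum0 : 0 ≤ ∑ r ∈ Icc 1 n, f r ^ 2 := sum_nonneg fun r _ => sq_nonneg _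
  -- denominator `≤ (1 + K u) L`
  have hden : 1 + 2 * s * C₁ ^ 2 * ∑ r ∈ Icc 1 n, f r ^ 2 ≤ (1 + K * u) * L := by
    have h1 : 2 * s * C₁ ^ 2 * ∑ r ∈ Icc 1 n, f r ^ 2 ≤ 2 * 1 * C₁ ^ 2 * (c⁻¹ * u * L) := by
      have ha : 2 * s * C₁ ^ 2 ≤ 2 * 1 * C₁ ^ 2 := by nlinarith [sq_nonneg C₁]
      calc 2 * s * C₁ ^ 2 * ∑ r ∈ Icc 1 n, f r ^ 2 ≤ 2 * 1 * C₁ ^ 2 * ∑ r ∈ Icc 1 n, f r ^ 2 :=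
            mul_le_mul_of_nonneg_right ha hsum0
        _ ≤ 2 * 1 * C₁ ^ 2 * (c⁻¹ * u * L) := by
            refine mul_le_mul_of_nonneg_left hsum ?_
            positivity
    have h2 : 2 * 1 * C₁ ^ 2 * (c⁻¹ * u * L) = K * u * L := by rw [hK]; field_simp
    have h3 : (1 : ℝ) ≤ L := hL1
    calc 1 + 2 * s * C₁ ^ 2 * ∑ r ∈ Icc 1 n, f r ^ 2 ≤ L + K * u * L := by linarith [h1, h2]
      _ = (1 + K * u) * L := by ring
  have hden0 : 0 < 1 + 2 * s * C₁ ^ 2 * ∑ r ∈ Icc 1 n, f r ^ 2 := by positivity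
  -- numerator `≥ s c₄² u`
  have hnum : s * c₄ ^ 2 * u ≤ s * n * α ^ 2 := by
    have hα0 : 0 ≤ c₄ * f n := by have := hf n; positivity
    have hsq : (c₄ * f n) ^ 2 ≤ α ^ 2 := pow_le_pow_left₀ hα0 hα 2
    have hn0 : (0 : ℝ) ≤ n := by positivity
    calc s * c₄ ^ 2 * u = s * n * (c₄ * f n) ^ 2 := by rw [hu]; ring
      _ ≤ s * n * α ^ 2 := by
          refine mul_le_mul_of_nonneg_left hsq ?_
          positivity
  -- assemble: target ≤ s c₄² · (u / (1 + K u)) / L ≤ numerator / denominator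
  have step1 : c₄ ^ 2 * u₀ / (1 + K * u₀) * s / L ≤ c₄ ^ 2 * u / (1 + K * u) * s / L := by
    have hm := div_one_add_mul_mono hK0 hu₀0.le hu₀u
    have : c₄ ^ 2 * u₀ / (1 + K * u₀) ≤ c₄ ^ 2 * u / (1 + K * u) := by
      have e1 : c₄ ^ 2 * u₀ / (1 + K * u₀) = c₄ ^ 2 * (u₀ / (1 + K * u₀)) := by ring
      have e2 : c₄ ^ 2 * u / (1 + K * u) = c₄ ^ 2 * (u / (1 + K * u)) := by ring
      rw [e1, e2]
      exact mul_le_mul_of_nonneg_left hm (sq_nonneg _)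
    have : c₄ ^ 2 * u₀ / (1 + K * u₀) * s ≤ c₄ ^ 2 * u / (1 + K * u) * s :=
      mul_le_mul_of_nonneg_right this hs0.le
    exact div_le_div_of_nonneg_right this hL0.le
  have step2 : c₄ ^ 2 * u / (1 + K * u) * s / L =
      (s * c₄ ^ 2 * u) / ((1 + K * u) * L) := by
    have h1 : 0 < 1 + K * u := by positivity
    field_simp
  have step3 : (s * c₄ ^ 2 * u) / ((1 + K * u) * L) ≤
      s * n * α ^ 2 / (1 + 2 * s * C₁ ^ 2 * ∑ r ∈ Icc 1 n, f r ^ 2) := by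
    have h1 : 0 < (1 + K * u) * L := by positivity
    calc (s * c₄ ^ 2 * u) / ((1 + K * u) * L)
        ≤ (s * c₄ ^ 2 * u) / (1 + 2 * s * C₁ ^ 2 * ∑ r ∈ Icc 1 n, f r ^ 2) := by
          refine div_le_div_of_nonneg_left ?_ hden0 hden
          have := hf n; positivity
      _ ≤ s * n * α ^ 2 / (1 + 2 * s * C₁ ^ 2 * ∑ r ∈ Icc 1 n, f r ^ 2) :=
          div_le_div_of_nonneg_right hnum hden0.le
  calc c₄ ^ 2 * (c * f 1 ^ 2) / (1 + 2 * C₁ ^ 2 / c * (c * f 1 ^ 2)) * s / (1 + Real.log n)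
      = c₄ ^ 2 * u₀ / (1 + K * u₀) * s / L := by rw [hu₀, hK, hL]
    _ ≤ c₄ ^ 2 * u / (1 + K * u) * s / L := step1
    _ = (s * c₄ ^ 2 * u) / ((1 + K * u) * L) := step2
    _ ≤ s * n * α ^ 2 / (1 + 2 * s * C₁ ^ 2 * ∑ r ∈ Icc 1 n, f r ^ 2) := step3

/-- **The matching constant is positive.** [folklore] -/
theorem matching_const_pos {f : ℕ → ℝ} {c c₄ C₁ : ℝ} (hc : 0 < c) (hf : ∀ k, 0 < f k) (hc₄ : 0 < c₄) :
    0 < c₄ ^ 2 * (c * f 1 ^ 2) / (1 + (2 * C₁ ^ 2 / c) * (c * f 1 ^ 2)) := by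
  have := hf 1
  positivity

/-! ## Divergence of `Σ 1/(A + j B)` (the Borel–Cantelli series over the scales `N_j = 4^j N₀`) -/

/-- For `A, B > 0` the partial sums `Σ_{j < m} 1/(A + j B)` are unbounded (comparison with the harmonic series:
`1/(A + jB) ≥ 1/((A + B)(j + 1))`). [folklore] -/
theorem tendsto_sum_inv_affine_atTop {A B : ℝ} (hA : 0 < A) (hB : 0 < B) :
    Filter.Tendsto (fun m : ℕ => ∑ j ∈ range m, 1 / (A + j * B)) Filter.atTop Filter.atTop := by
  -- compare with `(A + B)⁻¹ · Σ_{j<m} 1/(j+1)`, which diverges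
  have hcmp : ∀ m : ℕ, (A + B)⁻¹ * ∑ j ∈ range m, (1 : ℝ) / (j + 1) ≤ ∑ j ∈ range m, 1 / (A + j * B) := by
    intro m
    rw [mul_sum]
    refine sum_le_sum fun j _ => ?_
    have hj : (0 : ℝ) ≤ j := by positivity
    have h1 : 0 < A + j * B := by positivity
    have h2 : (0 : ℝ) < j + 1 := by positivity
    have h3 : 0 < A + B := by positivity
    rw [← one_div, div_mul_div_comm, one_mul, div_le_div_iff₀ (by positivity) h1]
    nlinarith [mul_nonneg hj hA.le, mul_nonneg hj hB.le]
  have hharm : Filter.Tendsto (fun m : ℕ => ∑ j ∈ range m, (1 : ℝ) / (j + 1)) Filter.atTop Filter.atTop := by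
    have h := Real.tendsto_sum_range_one_div_nat_succ_atTop
    exact h
  have h2 : Filter.Tendsto (fun m : ℕ => (A + B)⁻¹ * ∑ j ∈ range m, (1 : ℝ) / (j + 1))
      Filter.atTop Filter.atTop :=
    Filter.Tendsto.const_mul_atTop (inv_pos.2 (by positivity)) hharm
  exact Filter.tendsto_atTop_mono hcmp h2

end Ray

end Summit.CriticalPhenomena.PercolationContinuityZ3.Theorems.TransplantSharpness
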